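import Mathlib
import Literature.Computability.QuantumComplexity.QueryComplexity
import Literature.Computability.Complexity.SliceFunctions
import HarnessLib

/-!
# Aaronson–Ambainis: `R(f) = O(Q(f)²)` for every partial SYMMETRIC Boolean function (the Boolean case of the
# «need for structure» ceiling) — named fact

Source: S. Aaronson, A. Ambainis, *The need for structure in quantum speedups*, Theory of Computing 10 (6)
(2014) 133–166 [AaronsonAmbainis2014]; read on the page in the ToC offprint (held text
`paper:doi-10-4086-toc-2014-v010a006`, Appendix 5 «The Boolean case», p. 158 = chunk p0026 L28–L36) and in
arXiv:0911.0996v3 (held text `paper:arxiv-0911.0996`, Appendix 6, chunk p0018 L1–16), whose single counter numbers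
the same statement **Theorem 27**; the ToC offprint numbers it **Theorem 5.1**:

> «Given a partial Boolean function `f : {0,1}^N → {0,1,∗}`, call `f` symmetric if `f(X)` depends only on the Hamming
> weight `|X| := x_1 + ⋯ + x_N`. For completeness, in this appendix we prove the following basic fact:
> **Theorem 5.1.** `R(f) = O(Q(f)²)` for every partial symmetric Boolean function `f`.
> For total symmetric Boolean functions, Theorem 5.1 was already shown by Beals et al. [9], using an approximation
> theory result of Paturi [28]. Indeed, in the total case one even has `D(f) = O(Q(f)²)`. So the new twist is just
> that `f` can be partial.»

with the paper's measures (§1, p. 135 = p0003 L18–21): «The (bounded-error) randomized query complexity `R(f)` is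
the expected number of queries made by an optimal randomized algorithm that, for every `X ∈ S`, computes `f(X)` with
probability at least `2/3`. The (bounded-error) quantum query complexity `Q(f)` is the same as `R(f)`, except that
we allow quantum algorithms.» The printed proof (Lemma 5.2 = the adversary lower bound `Q(f) = Ω(√(bN)/(b−a))` for a
`0/1` jump between Hamming weights `a < b`, `a ≤ N/2`; Lemma 5.3 = Chernoff sampling with `T = O(γ²)` queries, a
FIXED query budget) bounds the worst-case number of queries, so the statement holds verbatim for the tree's
worst-case measures, which are the ones typed here:
`R(f) = Literature.Computability.Complexity.randQueryComplexityOn (1/3) S f` (distributions over decision trees of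
depth `≤ d`, correct with probability `≥ 2/3` on every `x ∈ S`) and
`Q(f) = Literature.Computability.Cryptography.quantumQueryComplexityOn (1/3) S f` (`QQueryAlg`, `ComputesWithError`),
both existing (`Complexity/DecisionTree.lean`, `Cryptography/QuantumQuery.lean`, used in the same rôle by
`simon_lower` of `QueryComplexity.lean`); nothing is restated.

What is typed: `IsSymmetricPartial S f` (the printed notion: domain AND values invariant under permuting the `N`
input positions — for a partial function `{0,1}^N → {0,1,∗}` «depends only on `|X|`» constrains the `∗`-set too),
its two sanity lemmas (`hammingWeight` is permutation invariant; a weight-defined promise problem is symmetric),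
and the theorem as ONE named fact `aaronsonAmbainis2014_symmetricPartial` (`∃ C, ∀ N S f, symmetric →
R(f) ≤ C · Q(f)²`; the `O(·)` rendered as a universal multiplicative constant, the convention of the tree's
`bealsEtAl2001_thm54` `D(f) ≤ 4096 · Q₂(f)⁶`; when `Q(f) = 0` the function is constant on `S` and `R(f) = 0`, so no
additive slack is needed). Appended for the discharge (cell line L-30, STATUS l.881): promise-extensionality
`randQueryComplexityOn_congr` / `quantumQueryComplexityOn_congr`, the orbit lemma (`exists_perm_comp_eq_of_hammingWeight_eq`,
`IsSymmetricPartial.exists_weightForm`) and the equivalence of the fact with its weight-data form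
(`aaronsonAmbainis2014_symmetricPartial_of_weightForm`, `weightForm_of_aaronsonAmbainis2014_symmetricPartial`) — all PROVED.
NOT proved here: the fact itself; its proof needs Ambainis's adversary theorem in weighted form (the
tree's `SpectralAdversary.lean` is the positive-weight method for TOTAL inputs sets; the promise version with the
`√((N−a)/(b−a) · b/(b−a))` bound is not in the tree) and a Chernoff sampling bound for decision-tree distributions —
an L-sized discharge, recorded for a prover seat; this file adds exactly one unproved fact (authorised: cell
`qa-lwe` LIT-3 queue Q4, idea-12 «quantum-speedup-ceilings», census row QA-A21; the catalogue entry
`Barriers/QuantumAdvantage/Catalogue.lean` QA-A09 lists «symmetric partial functions, AA Thm 27, not typed»).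

Neighbours: `Literature/Barriers/QuantumAdvantage/TotalFunctionSpeedupLimit.lean` (the TOTAL-function ceiling
`D(f) ≤ 4096·Q₂(f)⁶`, proved; `not_totalSpeedupBeyond_four` granted ABKRT), `AaronsonAmbainis.lean` (Conjectures
4/6 = ToC 1.5/1.7 OPEN, Theorem 7 = ToC 1.8 discharged), `SupportBoundedQuerySimulation.lean`,
`ParallelQueryHybridBound.lean`. The general permutation-invariant statement for NON-Boolean alphabets
(«`R(f) = O(Q(f)⁷ polylog Q(f))`», ToC Thm. 1.6 / §2) is a different theorem and is NOT typed here.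
-/

namespace Literature.Computability.QuantumComplexity

open Finset Literature.Computability.Complexity Literature.Computability.Cryptography

variable {N : ℕ}

/-- **Partial symmetric Boolean function** («Given a partial Boolean function `f : {0,1}^N → {0,1,∗}`, call `f`
symmetric if `f(X)` depends only on the Hamming weight `|X|`»): the promise set `S` (where `f ≠ ∗`) and the values
of `f` on `S` are invariant under every permutation of the `N` input positions — equivalently, membership in `S`
and the value depend only on `|X|` (`S_N` acts transitively on each Hamming level).
[cite: AaronsonAmbainis2014, Appendix 5 (ToC p. 158; arXiv v3 Appendix 6, before Thm. 27)] -/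
def IsSymmetricPartial (S : Set (Fin N → Bool)) (f : (Fin N → Bool) → Bool) : Prop :=
  ∀ σ : Equiv.Perm (Fin N), ∀ x ∈ S, x ∘ σ ∈ S ∧ f (x ∘ σ) = f x

/-- The Hamming weight `|X|` is invariant under permuting positions. [cite: AaronsonAmbainis2014, Appendix 5 (ToC p. 158, «depends only on the Hamming weight»)] -/
theorem hammingWeight_comp_perm (x : Fin N → Bool) (σ : Equiv.Perm (Fin N)) :
    hammingWeight (x ∘ σ) = hammingWeight x := by
  unfold hammingWeight
  rw [← Finset.card_map σ.toEmbedding]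
  congr 1
  ext j
  simp only [Function.comp_apply, Finset.mem_map, Finset.mem_filter, Finset.mem_univ, true_and,
    Equiv.toEmbedding_apply]
  constructor
  · rintro ⟨i, hi, rfl⟩
    exact hi
  · intro hj
    exact ⟨σ.symm j, by simpa using hj, σ.apply_symm_apply j⟩

/-- A promise problem GIVEN through the Hamming weight — `S = {X : P |X|}`, `f X = g |X|` — is a partial symmetric
Boolean function in the above sense (the form in which the paper uses the notion: «let `f(k) ∈ {0,1,∗}` be the
value of `f` on all inputs of Hamming weight `k`»). [cite: AaronsonAmbainis2014, Appendix 5 (ToC p. 158, after Thm. 5.1)] -/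
theorem isSymmetricPartial_of_weight (P : ℕ → Prop) (g : ℕ → Bool) :
    IsSymmetricPartial (N := N) {x | P (hammingWeight x)} (fun x => g (hammingWeight x)) := by
  intro σ x hx
  refine ⟨?_, ?_⟩
  · simpa [Set.mem_setOf_eq, hammingWeight_comp_perm] using hx
  · simp [hammingWeight_comp_perm]

/-- **Aaronson–Ambainis, Theorem 5.1 (ToC) = Theorem 27 (arXiv v3): «`R(f) = O(Q(f)²)` for every partial
symmetric Boolean function `f`»** — there is a universal constant `C` such that for every `N`, every promise set
`S ⊆ {0,1}^N` and every `f` with `(S, f)` symmetric, the bounded-error randomized query complexity on `S` is at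
most `C` times the square of the bounded-error quantum query complexity on `S` (tree measures
`randQueryComplexityOn (1/3)` / `quantumQueryComplexityOn (1/3)`, worst-case query counts — the printed proof's
sampling algorithm has a fixed budget `T = O(γ²)`, `γ = max_{f(a)=0,f(b)=1} √(bN)/(b−a)`, against the adversary
bound `Q(f) = Ω(γ)` of Lemma 5.2). This is the Boolean (`M = 2`) case of the permutation-invariance question
of ToC §1 (p. 136: it «follows relatively easily from known results: indeed, we prove in Appendix 5 that
`R(f) = O(Q(f)²)` in that case»). A THEOREM in print (proved in the source's Appendix 5), recorded as a named fact
(users: `(h : aaronsonAmbainis2014_symmetricPartial)`); proof = Ambainis's weighted adversary method on the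
Hamming levels `a < b` plus Chernoff sampling, not yet in the tree.
[cite: AaronsonAmbainis2014, Thm. 5.1 (ToC 10(6) p. 158, Appendix 5) = arXiv:0911.0996v3 Thm. 27] -/
def aaronsonAmbainis2014_symmetricPartial : Prop :=
  ∃ C : ℕ, ∀ (N : ℕ) (S : Set (Fin N → Bool)) (f : (Fin N → Bool) → Bool), IsSymmetricPartial S f →
    randQueryComplexityOn (1 / 3) S f ≤ C * quantumQueryComplexityOn (1 / 3) S f ^ 2


/-! ### Bridges for the discharge (cell `qa-lwe`, line L-30 «symmetric-speedup-ceiling», STATUS l.881 shape request):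
promise-extensionality of both measures, the orbit lemma, and the weight-data form of the fact -/

/-- **Promise-extensionality of `R_ε` on a promise set**: the randomized query complexity on `D` reads `f` only on `D`.
[cite: Wolf2002, §2.2] -/
theorem randQueryComplexityOn_congr {n : ℕ} {ε : ℝ} {D : Set (Fin n → Bool)} {f f' : (Fin n → Bool) → Bool}
    (h : ∀ x ∈ D, f x = f' x) : randQueryComplexityOn ε D f = randQueryComplexityOn ε D f' := by
  unfold randQueryComplexityOn
  have hs : ∀ x ∈ D, {T : DecisionTree n | T.eval x = f x} = {T | T.eval x = f' x} := fun x hx =>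
    Set.ext fun T => by rw [Set.mem_setOf_eq, Set.mem_setOf_eq, h x hx]
  have key : ∀ μ : PMF (DecisionTree n),
      (∀ x ∈ D, 1 - ε ≤ (μ.toOuterMeasure {T | T.eval x = f x}).toReal) ↔
        ∀ x ∈ D, 1 - ε ≤ (μ.toOuterMeasure {T | T.eval x = f' x}).toReal := fun μ =>
    forall₂_congr fun x hx => by rw [hs x hx]
  simp_rw [key]

/-- **Promise-extensionality of `Q_ε` on a promise set**: the quantum query complexity on `D` reads `f` only on `D`.
[cite: Wolf2002, §3] -/
theorem quantumQueryComplexityOn_congr {N : ℕ} {ε : ℝ} {D : Set (Fin N → Bool)} {f f' : (Fin N → Bool) → Bool}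
    (h : ∀ x ∈ D, f x = f' x) : quantumQueryComplexityOn ε D f = quantumQueryComplexityOn ε D f' := by
  unfold quantumQueryComplexityOn
  have hc : ∀ A : QQueryAlg N, A.ComputesWithError ε D f ↔ A.ComputesWithError ε D f' := fun A => by
    unfold QQueryAlg.ComputesWithError
    exact forall₂_congr fun x hx => by rw [h x hx]
  simp_rw [hc]

/-- **`S_N` acts transitively on each Hamming level**: two strings of the same weight differ by a permutation of the
positions (`x ∘ σ = y`): match the `1`-positions of `y` with those of `x` and the `0`-positions likewise
(`Fintype.equivOfCardEq` on the two pairs of subtypes, glued by `Equiv.sumCompl`). This is the step that makes «depends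
only on `|X|`» equivalent to permutation invariance. [cite: AaronsonAmbainis2014, Appendix 5 (ToC p. 158, «call f symmetric if f(X) depends only on the Hamming weight»)] -/
theorem exists_perm_comp_eq_of_hammingWeight_eq {x y : Fin N → Bool} (h : hammingWeight x = hammingWeight y) :
    ∃ σ : Equiv.Perm (Fin N), x ∘ σ = y := by
  classical
  have hc : Fintype.card {i // y i = true} = Fintype.card {i // x i = true} := by
    rw [Fintype.card_subtype, Fintype.card_subtype]
    exact h.symm
  have hc' : Fintype.card {i // ¬ y i = true} = Fintype.card {i // ¬ x i = true} := by
    rw [Fintype.card_subtype_compl, Fintype.card_subtype_compl, hc]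
  let e : {i // y i = true} ≃ {i // x i = true} := Fintype.equivOfCardEq hc
  let e' : {i // ¬ y i = true} ≃ {i // ¬ x i = true} := Fintype.equivOfCardEq hc'
  let σ : Equiv.Perm (Fin N) :=
    (Equiv.sumCompl fun i => y i = true).symm.trans ((e.sumCongr e').trans (Equiv.sumCompl fun i => x i = true))
  refine ⟨σ, funext fun i => ?_⟩
  simp only [Function.comp_apply]
  by_cases hi : y i = true
  · have hσ : σ i = (e ⟨i, hi⟩ : {j // x j = true}).1 := by
      show (Equiv.sumCompl fun j => x j = true) (Sum.map e e' ((Equiv.sumCompl fun j => y j = true).symm i)) = _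
      rw [Equiv.sumCompl_symm_apply_of_pos (p := fun j => y j = true) hi, Sum.map_inl, Equiv.sumCompl_apply_inl]
    rw [hσ, (e ⟨i, hi⟩).2, hi]
  · have hσ : σ i = (e' ⟨i, hi⟩ : {j // ¬ x j = true}).1 := by
      show (Equiv.sumCompl fun j => x j = true) (Sum.map e e' ((Equiv.sumCompl fun j => y j = true).symm i)) = _
      rw [Equiv.sumCompl_symm_apply_of_neg (p := fun j => y j = true) hi, Sum.map_inr, Equiv.sumCompl_apply_inr]
    rw [hσ]
    have hx := (e' ⟨i, hi⟩).2
    rw [Bool.not_eq_true] at hx hi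
    rw [hx, hi]

/-- **Orbit lemma**: a partial symmetric Boolean function in the permutation sense IS given by weight data — its
promise set is a union of Hamming levels `{X : |X| ∈ W}` and on it `f(X) = g(|X|)` (the paper's «abusing notation, let
`f(k) ∈ {0,1,∗}` be the value of `f` on all inputs of Hamming weight `k`»). [cite: AaronsonAmbainis2014, Appendix 5 (ToC p. 158, after Thm. 5.1)] -/
theorem IsSymmetricPartial.exists_weightForm {S : Set (Fin N → Bool)} {f : (Fin N → Bool) → Bool}
    (h : IsSymmetricPartial S f) :
    ∃ (W : Set ℕ) (g : ℕ → Bool), S = {x | hammingWeight x ∈ W} ∧ ∀ x ∈ S, f x = g (hammingWeight x) := by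
  classical
  refine ⟨hammingWeight '' S,
    fun w => if hw : ∃ x ∈ S, hammingWeight x = w then f hw.choose else false, ?_, ?_⟩
  · ext y
    constructor
    · intro hy
      exact ⟨y, hy, rfl⟩
    · rintro ⟨x, hx, hxy⟩
      obtain ⟨σ, rfl⟩ := exists_perm_comp_eq_of_hammingWeight_eq hxy
      exact (h σ x hx).1
  · intro x hx
    have hex : ∃ x' ∈ S, hammingWeight x' = hammingWeight x := ⟨x, hx, rfl⟩
    dsimp only
    rw [dif_pos hex]
    obtain ⟨hcS, hcw⟩ := hex.choose_spec
    obtain ⟨σ, hσ⟩ := exists_perm_comp_eq_of_hammingWeight_eq hcw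
    have key : f (hex.choose ∘ σ) = f hex.choose := (h σ _ hcS).2
    rw [hσ] at key
    exact key

/-- **The weight-data form implies the fact** (the shape in which line L-30's `WeightClassCeiling` — stated over
`symSet N W = {x | Grover.hw x ∈ W}`, `symFn N g = g ∘ Grover.hw`, `Grover.hw x = hammingWeight x` by `rfl` — discharges
`aaronsonAmbainis2014_symmetricPartial` in one line: `… ⟨C, weightClassCeiling⟩`): if `R_{1/3} ≤ C·Q_{1/3}²` holds for
every weight-defined promise problem, it holds for every partial symmetric `f` (orbit lemma + promise-extensionality).
[cite: AaronsonAmbainis2014, Thm. 5.1 (ToC p. 158) = arXiv v3 Thm. 27] -/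
theorem aaronsonAmbainis2014_symmetricPartial_of_weightForm
    (h : ∃ C : ℕ, ∀ (N : ℕ) (W : Set ℕ) (g : ℕ → Bool),
      randQueryComplexityOn (1 / 3) {x : Fin N → Bool | hammingWeight x ∈ W} (fun x => g (hammingWeight x)) ≤
        C * quantumQueryComplexityOn (1 / 3) {x : Fin N → Bool | hammingWeight x ∈ W}
          (fun x => g (hammingWeight x)) ^ 2) :
    aaronsonAmbainis2014_symmetricPartial := by
  obtain ⟨C, hC⟩ := h
  refine ⟨C, fun N S f hS => ?_⟩
  obtain ⟨W, g, rfl, hfg⟩ := hS.exists_weightForm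
  rw [randQueryComplexityOn_congr hfg, quantumQueryComplexityOn_congr hfg]
  exact hC N W g

/-- … and conversely the fact gives the weight-data form (weight-defined problems are symmetric,
`isSymmetricPartial_of_weight`), so the two shapes are equivalent. [cite: AaronsonAmbainis2014, Thm. 5.1 (ToC p. 158) = arXiv v3 Thm. 27] -/
theorem weightForm_of_aaronsonAmbainis2014_symmetricPartial (h : aaronsonAmbainis2014_symmetricPartial) :
    ∃ C : ℕ, ∀ (N : ℕ) (W : Set ℕ) (g : ℕ → Bool),
      randQueryComplexityOn (1 / 3) {x : Fin N → Bool | hammingWeight x ∈ W} (fun x => g (hammingWeight x)) ≤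
        C * quantumQueryComplexityOn (1 / 3) {x : Fin N → Bool | hammingWeight x ∈ W}
          (fun x => g (hammingWeight x)) ^ 2 := by
  obtain ⟨C, hC⟩ := h
  exact ⟨C, fun N W g => hC N _ _ (isSymmetricPartial_of_weight (N := N) (· ∈ W) g)⟩

end Literature.Computability.QuantumComplexity
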